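import Summits.AnomalousDissipation.AnomalousDissipation.Theorems.MomentLadder.Negative.Clauses
import Summits.AnomalousDissipation.AnomalousDissipation.Theorems.QuarticGate.Negative.Laminar

/-!
# Negative knowledge for the crux `MomentParity.MomentLadder` (stmt-AnomalousDissipation-11463):
# III — load-bearing clauses (weakenings that hold trivially) and the shape of a refutation

Certified copy of sections D/E of `Cruxes/MomentLadder/Disproof.lean` (refuter-cdisprove-stmt-AnomalousDissipation-11463-0,
cycle 1). Supports stmt-AnomalousDissipation-11463; no positive route-item statement is asserted (the three
`…_holds` theorems prove WEAKENINGS of the crux obtained by deleting one clause; they are not route items).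

* `momentLadderWithoutEpsPos_holds` — without `0 < ε`, `δ₀` with `f = 0` satisfies every other clause at
  every order (`isResolved_dirac_zero`, `isSupported_dirac`, `eGradNormSq_coe_zero`).
* `momentLadderWithoutEnergyCeiling_holds` — without `ensembleEnergy μ ≤ E`, the laminar Kolmogorov Diracs
  `δ_{[K_{a_j}]}`, `a_j = (4π²ν_j)⁻¹`, radius `a_j`, schedule `κ ≡ 1`, stationary at every order, are loud
  (`isResolved_dirac_of_isLevel`, `eGradNormSq_fourierTruncate_of_isLevel`, `norm_kolState_le`).
* `momentLadderWithoutVanishingViscosity_holds` — without `ν_j → 0`, the same Dirac at `ν ≡ 1`.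
* `not_momentLadder_iff` — a refutation is a uniform quietness theorem (`∃ j ∀ R κ ∀ᶠ N ∃ d ∀ μ`).
-/

namespace Summit.AnomalousDissipation.AnomalousDissipation.Theorems.MomentLadder.Negative

open MeasureTheory Filter Topology
open scoped ENNReal InnerProductSpace RealInnerProductSpace
open Literature.Analysis.FunctionSpaces Literature.Analysis.FluidPDE
open Summit.AnomalousDissipation.AnomalousDissipation.Theses.MomentParity
open Summit.AnomalousDissipation.AnomalousDissipation.Theorems.QuarticGate.Negative

noncomputable section

/-! ## D. Load-bearing clauses: the weakenings that hold trivially -/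

section LoadBearing

/-- The spectral enstrophy of the representative of `0 ∈ H` vanishes. [folklore] -/
theorem eGradNormSq_coe_zero :
    Torus.eGradNormSq (((0 : Torus.energySpace (Fin 3)).1 :
      Lp (EuclideanSpace ℝ (Fin 3)) 2 (volume : Measure (UnitAddTorus (Fin 3)))) :
        UnitAddTorus (Fin 3) → EuclideanSpace ℝ (Fin 3)) = 0 := by
  rw [Torus.eGradNormSq_eq_tsum]
  simp_rw [mFourierCoeff_coe_zero]
  simp

/-- `δ₀` is resolved by every schedule. [folklore] -/
theorem isResolved_dirac_zero (κ : ℕ → ℕ) :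
    IsResolved κ (Measure.dirac (0 : Torus.energySpace (Fin 3))) := by
  haveI : MeasurableSingletonClass (Torus.energySpace (Fin 3)) :=
    OpensMeasurableSpace.toMeasurableSingletonClass
  intro n
  rw [lintegral_dirac, eGradNormSq_coe_zero]
  exact zero_le

/-- The truncation at a cutoff above the level does not change the spectral enstrophy. [folklore] -/
theorem eGradNormSq_fourierTruncate_of_isLevel {K M : ℕ} {U : Torus.energySpace (Fin 3)}
    (hU : IsLevel K U) (hKM : K ≤ M) :
    Torus.eGradNormSq (Torus.fourierTruncate M (U.1 : UnitAddTorus (Fin 3) → EuclideanSpace ℝ (Fin 3))) =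
      Torus.eGradNormSq (U.1 : UnitAddTorus (Fin 3) → EuclideanSpace ℝ (Fin 3)) := by
  have hint : Integrable (U.1 : UnitAddTorus (Fin 3) → EuclideanSpace ℝ (Fin 3)) volume :=
    (Lp.memLp U.1).integrable one_le_two
  rw [Torus.eGradNormSq_eq_tsum, Torus.eGradNormSq_eq_tsum]
  congr 1
  refine tsum_congr fun k => ?_
  rw [Torus.mFourierCoeff_fourierTruncate hint]
  split_ifs with hk
  · rfl
  · rw [hU k fun hk' => hk (Torus.freqBall_mono hKM (Finset.mem_of_mem_erase hk'))]

/-- A Dirac mass at a level-`K` state is resolved by every schedule `κ ≥ K`. [folklore] -/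
theorem isResolved_dirac_of_isLevel {K : ℕ} {U : Torus.energySpace (Fin 3)} (hU : IsLevel K U)
    {κ : ℕ → ℕ} (hκ : ∀ n, K ≤ κ n) : IsResolved κ (Measure.dirac U) := by
  haveI : MeasurableSingletonClass (Torus.energySpace (Fin 3)) :=
    OpensMeasurableSpace.toMeasurableSingletonClass
  intro n
  rw [lintegral_dirac, lintegral_dirac, eGradNormSq_fourierTruncate_of_isLevel hU (hκ n)]
  exact le_self_add

/-- A Dirac mass is supported in the ball of its own radius. [folklore] -/
theorem isSupported_dirac (U : Torus.energySpace (Fin 3)) {R : ℝ} (hR : ‖U‖ ≤ R) :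
    IsSupported R (Measure.dirac U) := by
  haveI : MeasurableSingletonClass (Torus.energySpace (Fin 3)) :=
    OpensMeasurableSpace.toMeasurableSingletonClass
  unfold IsSupported
  rw [ae_dirac_eq]
  simpa using hR

/-- WEAKENING 1 (holds trivially): `MomentLadder` without `0 < ε`. -/
def MomentLadderWithoutEpsPos : Prop :=
  ∃ f : UnitAddTorus (Fin 3) → EuclideanSpace ℝ (Fin 3),
    Torus.IsSmooth f ∧ Torus.IsDivFree f ∧ Torus.HasZeroMean f ∧
    ∃ (ν : ℕ → ℝ) (E ε : ℝ), (∀ j, 0 < ν j) ∧ Tendsto ν atTop (𝓝 0) ∧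
    ∀ j : ℕ, ∃ (R : ℝ) (κ : ℕ → ℕ), ∃ᶠ N in atTop, ∀ d : ℕ, ∃ μ,
      IsLadderWitness f (ν j) N E ε R κ d μ

/-- **`0 < ε` is load-bearing** — and every OTHER clause of the crux is jointly satisfiable: `δ₀` with
`f = 0`, `E = ε = 0`, `R = 0`, any `κ`, is a probability law, level-`N` for every `N`, supported,
resolved and stationary at EVERY order (all rows vanish identically). [folklore] -/
theorem momentLadderWithoutEpsPos_holds : MomentLadderWithoutEpsPos := by
  haveI : MeasurableSingletonClass (Torus.energySpace (Fin 3)) :=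
    OpensMeasurableSpace.toMeasurableSingletonClass
  have hzero : (Torus.realTrigPoly (∅ : Finset (Fin 3 → ℤ)) (0 : (Fin 3 → ℤ) → EuclideanSpace ℂ (Fin 3)))
      = fun _ => 0 := Torus.realTrigPoly_zero ∅
  refine ⟨fun _ => 0, Torus.isSmooth_const _, ?_, ?_, fun j => 1 / ((j : ℝ) + 1), 0, 0,
    fun j => by positivity, tendsto_one_div_add_atTop_nhds_zero_nat, fun j => ⟨0, fun _ => 0, ?_⟩⟩
  · rw [← hzero]
    exact Torus.isDivFree_realTrigPoly fun k hk => by simp at hk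
  · simp [Torus.HasZeroMean]
  refine Frequently.of_forall fun N d => ⟨Measure.dirac 0, inferInstance, ?_, isSupported_dirac 0 (by simp),
    isResolved_dirac_zero _, ?_, ?_, ?_⟩
  · rw [ae_dirac_eq]
    simp only [eventually_pure]
    intro k _
    exact mFourierCoeff_coe_zero k
  · intro m g P _ _
    refine ⟨Torus.integrable_dirac _ _, ?_⟩
    rw [integral_dirac]
    exact nsGeneratorPairing_zero_zero _ _
  · simp [Torus.ensembleEnergy, integral_dirac]
  · exact mul_nonneg (by positivity) ENNReal.toReal_nonneg

/-- `‖[K_a]‖ ≤ a` for `0 ≤ a` (`‖[K_a]‖² = a²/2`). [folklore] -/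
theorem norm_kolState_le {a : ℝ} (ha : 0 ≤ a) : ‖kolState a‖ ≤ a := by
  nlinarith [norm_nonneg (kolState a), norm_sq_kolState a]

/-- WEAKENING 2 (holds trivially): `MomentLadder` without the energy ceiling `ensembleEnergy μ ≤ E`
(everything else kept: support, resolution, stationarity at every order, loudness). -/
def MomentLadderWithoutEnergyCeiling : Prop :=
  ∃ f : UnitAddTorus (Fin 3) → EuclideanSpace ℝ (Fin 3),
    Torus.IsSmooth f ∧ Torus.IsDivFree f ∧ Torus.HasZeroMean f ∧
    ∃ (ν : ℕ → ℝ) (ε : ℝ), (∀ j, 0 < ν j) ∧ Tendsto ν atTop (𝓝 0) ∧ 0 < ε ∧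
    ∀ j : ℕ, ∃ (R : ℝ) (κ : ℕ → ℕ), ∃ᶠ N in atTop, ∀ d : ℕ, ∃ μ : Measure (Torus.energySpace (Fin 3)),
      IsProbabilityMeasure μ ∧ (∀ᵐ u ∂μ, IsLevel N u) ∧ IsSupported R μ ∧ IsResolved κ μ ∧
      IsPolyStationary (ν j) f N d μ ∧ ε ≤ Torus.ensembleDissipation (ν j) μ

/-- **The energy ceiling is load-bearing**: without it the laminar Kolmogorov Diracs
`δ_{[K_{a_j}]}`, `a_j = (4π²ν_j)⁻¹` (exact steady states at EVERY order, level 1, radius `R_j = a_j`,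
schedule `κ ≡ 1`, dissipation `(8π²ν_j)⁻¹ ≥ (8π²)⁻¹`) witness the statement for the fixed force
`K_1 = cos(2πx₁)e₀`. So the new clauses of the ladder (support, resolution) cost nothing on the
laminar branch: the content is energy-bounded loudness, as for `QuarticGate`. [folklore] -/
theorem momentLadderWithoutEnergyCeiling_holds : MomentLadderWithoutEnergyCeiling := by
  haveI : MeasurableSingletonClass (Torus.energySpace (Fin 3)) :=
    OpensMeasurableSpace.toMeasurableSingletonClass
  have hpi : 0 < Real.pi := Real.pi_pos
  refine ⟨kolField 1, isSmooth_kolField 1, isDivFree_kolField 1, hasZeroMean_kolField 1,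
    fun j => 1 / ((j : ℝ) + 1), (8 * Real.pi ^ 2)⁻¹, fun j => by positivity,
    tendsto_one_div_add_atTop_nhds_zero_nat, by positivity, fun j => ?_⟩
  set ν : ℝ := 1 / ((j : ℝ) + 1) with hν
  have hν0 : 0 < ν := by positivity
  have hν1 : ν ≤ 1 := by
    rw [hν, div_le_one (by positivity)]; linarith [(Nat.cast_nonneg j : (0 : ℝ) ≤ j)]
  set a : ℝ := (4 * Real.pi ^ 2 * ν)⁻¹ with ha
  have ha0 : 0 < a := by positivity
  have hforce : kolField 1 = kolField (4 * Real.pi ^ 2 * ν * a) := by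
    rw [ha, mul_inv_cancel₀ (by positivity)]
  refine ⟨a, fun _ => 1, (eventually_ge_atTop 1).frequently.mono fun N hN d => ?_⟩
  refine ⟨Measure.dirac (kolState a), inferInstance, ?_, isSupported_dirac _ (norm_kolState_le ha0.le),
    isResolved_dirac_of_isLevel (isLevel_kolState a le_rfl) fun _ => le_rfl, ?_, ?_⟩
  · rw [ae_dirac_eq]; simpa using isLevel_kolState a hN
  · rw [hforce]; exact isPolyStationary_dirac_kolState ν a N d
  · rw [ensembleDissipation_dirac_kolState, ha]
    have h1 : ν * (2 * Real.pi ^ 2 * ((4 * Real.pi ^ 2 * ν)⁻¹) ^ 2) = (8 * Real.pi ^ 2 * ν)⁻¹ := by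
      field_simp; ring
    rw [h1]
    exact inv_anti₀ (by positivity) (by nlinarith [hν1, hpi])

/-- WEAKENING 3 (holds trivially): `MomentLadder` without `ν_j → 0`. -/
def MomentLadderWithoutVanishingViscosity : Prop :=
  ∃ f : UnitAddTorus (Fin 3) → EuclideanSpace ℝ (Fin 3),
    Torus.IsSmooth f ∧ Torus.IsDivFree f ∧ Torus.HasZeroMean f ∧
    ∃ (ν : ℕ → ℝ) (E ε : ℝ), (∀ j, 0 < ν j) ∧ 0 < ε ∧
    ∀ j : ℕ, ∃ (R : ℝ) (κ : ℕ → ℕ), ∃ᶠ N in atTop, ∀ d : ℕ, ∃ μ,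
      IsLadderWitness f (ν j) N E ε R κ d μ

/-- **`ν_j → 0` is load-bearing**: at fixed viscosity `ν ≡ 1` the laminar Dirac `δ_{[K_a]}`,
`a = (4π²)⁻¹`, is a ladder witness at every level `N ≥ 1` and every order, with `E = a²/2`,
`ε = (8π²)⁻¹` (attaining the force floor of §C), `R = a`, `κ ≡ 1`. [folklore] -/
theorem momentLadderWithoutVanishingViscosity_holds : MomentLadderWithoutVanishingViscosity := by
  haveI : MeasurableSingletonClass (Torus.energySpace (Fin 3)) :=
    OpensMeasurableSpace.toMeasurableSingletonClass
  have hpi : 0 < Real.pi := Real.pi_pos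
  set a : ℝ := (4 * Real.pi ^ 2 * (1 : ℝ))⁻¹ with ha
  have ha0 : 0 < a := by positivity
  refine ⟨kolField 1, isSmooth_kolField 1, isDivFree_kolField 1, hasZeroMean_kolField 1,
    fun _ => 1, a ^ 2 / 2, (8 * Real.pi ^ 2 * (1 : ℝ))⁻¹, fun _ => one_pos, by positivity,
    fun j => ⟨a, fun _ => 1, (eventually_ge_atTop 1).frequently.mono fun N hN d => ?_⟩⟩
  obtain ⟨⟨hprob, hlev, -, -, hEn, hε⟩, -⟩ := isQuarticWitness_dirac_kolState one_pos hN
  have hforce : kolField 1 = kolField (4 * Real.pi ^ 2 * (1 : ℝ) * a) := by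
    rw [ha, mul_inv_cancel₀ (by positivity)]
  refine ⟨Measure.dirac (kolState a), hprob, hlev, isSupported_dirac _ (norm_kolState_le ha0.le),
    isResolved_dirac_of_isLevel (isLevel_kolState a le_rfl) fun _ => le_rfl, ?_, hEn, hε⟩
  rw [hforce]; exact isPolyStationary_dirac_kolState 1 a N d

end LoadBearing

/-! ## E. What a refutation must prove -/

section Shape

/-- **`¬ MomentLadder` unfolded**: a refutation is a UNIFORM QUIETNESS THEOREM — for every admissible
force, every positive `ν_j → 0` and all budgets, SOME viscosity `ν_j` is such that for EVERY radius
`R` and EVERY schedule `κ`, at all but finitely many levels `N` some order `d` admits no supported,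
resolved, loud `d`-stationary level-`N` law. By `MomentClosure` (support item) this is: no loud
Galerkin-INVARIANT law of energy `≤ E` supported in `B_R` is `κ`-resolved, frequently in `N` — i.e.
every bounded-energy family of invariant measures of 3-D Galerkin NS either laminarises
(`(f, ū) → 0`) N-frequently as `ν → 0`, or leaks enstrophy beyond every fixed cutoff as `N → ∞` at
fixed `ν`. Open both ways (it would be a converged-DNS "no zeroth law"). [folklore] -/
theorem not_momentLadder_iff :
    ¬ MomentLadder ↔ ∀ f : UnitAddTorus (Fin 3) → EuclideanSpace ℝ (Fin 3),
      Torus.IsSmooth f → Torus.IsDivFree f → Torus.HasZeroMean f →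
      ∀ (ν : ℕ → ℝ) (E ε : ℝ), (∀ j, 0 < ν j) → Tendsto ν atTop (𝓝 0) → 0 < ε →
      ∃ j : ℕ, ∀ (R : ℝ) (κ : ℕ → ℕ), ∀ᶠ N in atTop, ∃ d : ℕ, ∀ μ,
        ¬ IsLadderWitness f (ν j) N E ε R κ d μ := by
  rw [momentLadder_iff]
  simp only [not_exists, not_and, not_forall, Filter.not_frequently]

end Shape

end

end Summit.AnomalousDissipation.AnomalousDissipation.Theorems.MomentLadder.Negative
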